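import Summits.ResolutionOfSingularities.ResolutionOfSingularities.Theorems.MarkedTransferCampaignW22GraphPairSymbolicOrderCensus
import Summits.ResolutionOfSingularities.ResolutionOfSingularities.Theorems.MarkedTransferCampaignW22SymbolicOrderHasse
import Summits.ResolutionOfSingularities.ResolutionOfSingularities.Theorems.MarkedTransferCampaignW22PairRegLevelOneRoot
import HarnessLib

/-!
# [OURS · L1 W2.2 (γ)] THE PAIR-CELL REDUCTIONS ARE LEVELWISE: at a fixed level `q = p^e` the graph-triple row of p529003
# (levels `≤ e`) gives the served-head cell, the level-one cell and the head-free symbolic-order row of p521389 at level `e`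
# in dimension 5 (res-type-014's census p537671 and Hasse induction p527013 re-threaded level by level; RESCUE-SEED slot
# W2.2, group L-G2; cell `res-hironaka`, rung L of LADDER-RESOLUTION)

Cell `res-hironaka`, rung L, plan/RESCUE-SEED.md §1 row L-G2 slot W2.2; seat res-L1-s22-pv-1 (prover pv-1, gen 6); `--supports`
helper of `MarkedTransfer.MarkedOrderReductionP` (stmt-ResolutionOfSingularities-15520). Everything PROVED; no definitions.
HONEST FRAMING. Everything here is OURS; NOTHING here is a statement of H. Hironaka's manuscript *Resolution of singularities in
positive characteristics* (2017-03-23, [Hironaka2017], lit key `paper:url-3343fd9e678b`) or of any cited paper. The PROOFS are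
res-type-014's (`exists_orderSafeAt_mem_mem_five` p537671, `tangentPairSymbolicOrderOn_of_uniformContactPairRegLevelOneOn` p527013,
the head conversion of `…PairRegLevelOneRoot`), copied VERBATIM with the single change that the row hypotheses are taken AT THE
LEVELS `≤ e` instead of for all `e` — those files remain the files of record; this one lets a theorem at ONE level (this seat's
A(2): `e = 1`, `p = 2`, p551253) pass through the census. AI mathematics, kernel-checked; weaker than expert review.
CONTENTS (ns `…Theorems.CampaignW22`): `exists_orderSafeAt_mem_mem_five_of_level` (level-`e` census: graph row at level `e` ⇒
every permissible head of two proper coordinate centres of `K⟦X_{Fin 5}⟧` is served), `levelOne_five_of_level` (`Y − y ∈ 𝔪²`), `tangentPair_level_of_levelOne_levels` (`K⟦X_{Fin n}⟧`: level-one cells at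
levels `≤ E` ⇒ head-free row at levels `≤ E`). The dimension-5 combination and its `p = 2, E = 1` instance are the next file.

## References
* Tree: p537671, p527013, p524977 / `…W22PairRegLevelOneRoot.lean`, p529003, p521389 (res-type-014, res-L1-type-o3); p551253 (this
  seat). Cell: L/res-L1-s22-pv-1/KERNEL-A2-CHAR2.md.
* H. Hironaka, ms. 2017-03-23, p.85 l.3, p.84 l.41 — ROLES only; not cited as fact. [Hironaka2017] [claim: Hironaka2017, status: under-review]
-/

set_option linter.dupNamespace false -- mandated namespace of this single-conjunct summit

noncomputable section
namespace Summit.ResolutionOfSingularities.ResolutionOfSingularities.Theorems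
namespace CampaignW22

open IsLocalRing MvPowerSeries Literature.AlgebraicGeometry.Resolution
open Literature.AlgebraicGeometry.Hironaka2017.S06BaseHike
open Literature.RingTheory.MvPowerSeries
open Literature.RingTheory.MvPowerSeries.monoidPowerSeries (faceRestrictFun)

universe u v

section Levelwise
variable (p : ℕ) [hp : Fact p.Prime] (K : Type) [Field K] [CharP K p] [PerfectField K]

/-- [OURS · L1 W2.2] **LEVEL-`e` CENSUS** (res-type-014's `exists_orderSafeAt_mem_mem_five` p537671 with the graph-triple row
assumed AT LEVEL `e` ONLY; proof verbatim): a head `y^{p^e} + ε` (`ord y = 1`, `ord ε > p^e`) permissible for two proper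
coordinate centres of `K⟦X_{Fin 5}⟧` is served. NOT a statement of the manuscript or of any cited paper. [folklore] -/
theorem exists_orderSafeAt_mem_mem_five_of_level
    [IsRegularLocalRing (MvPowerSeries (Fin 5) K)] [IsRegularLocalRing (MvPowerSeries (Fin 4) K)] (e : ℕ)
    (hGKe : ∀ f : Fin 3 → MvPowerSeries (Fin 5) K,
      (∀ i, faceRestrictFun (R := K) (Finsupp.supported ℕ ℕ (({0, 1, 2} : Set (Fin 5))ᶜ)).toAddSubmonoid (f i) = f i) →
      (∀ i, constantCoeff (f i) = 0) →
      Ideal.span {(X 0 : MvPowerSeries (Fin 5) K), X 1, X 2} ⊓ Ideal.span {X 0 - f 0, X 1 - f 1, X 2 - f 2} ≤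
          maximalIdeal (MvPowerSeries (Fin 5) K) ^ 2 →
        Ideal.span {(X 0 : MvPowerSeries (Fin 5) K), X 1, X 2} ^ p ^ e ⊓
          Ideal.span {X 0 - f 0, X 1 - f 1, X 2 - f 2} ^ p ^ e ≤ maximalIdeal (MvPowerSeries (Fin 5) K) ^ (p ^ e + 1))
    {x₁ x₂ : Fin 5 → MvPowerSeries (Fin 5) K} (hx₁ : IsRegularSystemOfParameters x₁)
    (hx₂ : IsRegularSystemOfParameters x₂) (S₁ S₂ : Set (Fin 5)) (hS₁ : S₁.Nonempty) (hS₂ : S₂.Nonempty)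
    (y ε : MvPowerSeries (Fin 5) K) (hy : adicOrder y = 1) (hq : ((p ^ e : ℕ) : ℕ∞) < adicOrder ε)
    (hg₁ : y ^ p ^ e + ε ∈ Ideal.span (x₁ '' S₁) ^ p ^ e)
    (hg₂ : y ^ p ^ e + ε ∈ Ideal.span (x₂ '' S₂) ^ p ^ e) :
    ∃ Y : MvPowerSeries (Fin 5) K, OrderSafeAt p e y ε Y ∧ Y ∈ Ideal.span (x₁ '' S₁) ∧ Y ∈ Ideal.span (x₂ '' S₂) := by
  classical
  haveI : CharP (MvPowerSeries (Fin 5) K) p :=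
    charP_of_injective_ringHom (f := (MvPowerSeries.C : K →+* MvPowerSeries (Fin 5) K)) MvPowerSeries.C_injective p
  have h4 : UniformContactPairOn p (MvPowerSeries (Fin 4) K) := UniformContactPairDim_four_holds p K 4 le_rfl
  obtain ⟨T₁, rfl⟩ : ∃ T : Finset (Fin 5), (T : Set (Fin 5)) = S₁ := ⟨S₁.toFinite.toFinset, S₁.toFinite.coe_toFinset⟩
  obtain ⟨T₂, rfl⟩ : ∃ T : Finset (Fin 5), (T : Set (Fin 5)) = S₂ := ⟨S₂.toFinite.toFinset, S₂.toFinite.coe_toFinset⟩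
  have hpos₁ : 0 < T₁.card := Finset.card_pos.mpr (Finset.coe_nonempty.mp hS₁)
  have hpos₂ : 0 < T₂.card := Finset.card_pos.mpr (Finset.coe_nonempty.mp hS₂)
  -- (A) the listed shapes
  by_cases hT₁ : T₁.card ≠ 2 ∧ T₁.card ≠ 3
  · exact exists_orderSafeAt_mem_mem_of_card p K hx₁ hx₂ T₁ _ hpos₁ hT₁ e y ε hq hg₁ hg₂
  by_cases hT₂ : T₂.card ≠ 2 ∧ T₂.card ≠ 3
  · obtain ⟨Y, hY, h2, h1⟩ := exists_orderSafeAt_mem_mem_of_card p K hx₂ hx₁ T₂ _ hpos₂ hT₂ e y ε hq hg₂ hg₁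
    exact ⟨Y, hY, h1, h2⟩
  have hT₁' : T₁.card = 2 ∨ T₁.card = 3 := by omega
  have hT₂' : T₂.card = 2 ∨ T₂.card = 3 := by omega
  -- (B) a transversal frame element: one-sided descent
  by_cases htr₂ : ∃ j ∈ (↑T₂ : Set (Fin 5)), x₂ j ∉ Ideal.span (x₁ '' ↑T₁) ⊔ maximalIdeal (MvPowerSeries (Fin 5) K) ^ 2
  · obtain ⟨j₀, hj₀, hnot⟩ := htr₂
    exact exists_orderSafeAt_mem_mem_of_transversal_succ p K 4 h4 hx₁ hx₂ _ _ hS₁ hj₀ hnot e y ε hq hg₁ hg₂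
  by_cases htr₁ : ∃ i ∈ (↑T₁ : Set (Fin 5)), x₁ i ∉ Ideal.span (x₂ '' ↑T₂) ⊔ maximalIdeal (MvPowerSeries (Fin 5) K) ^ 2
  · obtain ⟨i₀, hi₀, hnot⟩ := htr₁
    obtain ⟨Y, hY, h2, h1⟩ :=
      exists_orderSafeAt_mem_mem_of_transversal_succ p K 4 h4 hx₂ hx₁ _ _ hS₂ hi₀ hnot e y ε hq hg₂ hg₁
    exact ⟨Y, hY, h1, h2⟩
  push Not at htr₁ htr₂
  -- (C) a common parameter of order one: descent
  by_cases hcom : ∃ f ∈ Ideal.span (x₁ '' ↑T₁) ⊓ Ideal.span (x₂ '' ↑T₂), f ∉ maximalIdeal (MvPowerSeries (Fin 5) K) ^ 2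
  · obtain ⟨f, hf, hf2⟩ := hcom
    exact exists_orderSafeAt_mem_mem_of_common_parameter_succ p K 4 h4 hx₁ hx₂ _ _ (Submodule.mem_inf.mp hf).1
      (Submodule.mem_inf.mp hf).2 hf2 e y ε hq hg₁ hg₂
  push Not at hcom
  -- ideal-level forms of tangency and of `P₁ ⊓ P₂ ≤ 𝔪²`
  have hP₁₂ : Ideal.span (x₁ '' ↑T₁) ≤ Ideal.span (x₂ '' ↑T₂) ⊔ maximalIdeal (MvPowerSeries (Fin 5) K) ^ 2 :=
    Ideal.span_le.mpr (by rintro _ ⟨i, hi, rfl⟩; exact htr₁ i hi)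
  have hP₂₁ : Ideal.span (x₂ '' ↑T₂) ≤ Ideal.span (x₁ '' ↑T₁) ⊔ maximalIdeal (MvPowerSeries (Fin 5) K) ^ 2 :=
    Ideal.span_le.mpr (by rintro _ ⟨j, hj, rfl⟩; exact htr₂ j hj)
  have hinf : Ideal.span (x₁ '' ↑T₁) ⊓ Ideal.span (x₂ '' ↑T₂) ≤ maximalIdeal (MvPowerSeries (Fin 5) K) ^ 2 :=
    fun f hf => hcom f hf
  -- pulling an order-one element or the square of `𝔪` back and forth through an automorphism
  have pull : ∀ (Ψ : MvPowerSeries (Fin 5) K ≃ₐ[K] MvPowerSeries (Fin 5) K) {P₁ P₂ : Ideal (MvPowerSeries (Fin 5) K)},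
      P₁ ⊓ P₂ ≤ maximalIdeal (MvPowerSeries (Fin 5) K) ^ 2 →
        P₁.map Ψ.symm ⊓ P₂.map Ψ.symm ≤ maximalIdeal (MvPowerSeries (Fin 5) K) ^ 2 := by
    intro Ψ P₁ P₂ hle g hg
    obtain ⟨hg1, hg2⟩ := Submodule.mem_inf.mp hg
    obtain ⟨g₁, hg₁m, hg₁e⟩ := (Ideal.mem_map_iff_of_surjective Ψ.symm Ψ.symm.surjective).mp hg1
    obtain ⟨g₂, hg₂m, hg₂e⟩ := (Ideal.mem_map_iff_of_surjective Ψ.symm Ψ.symm.surjective).mp hg2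
    have hg12 : g₁ = g₂ := Ψ.symm.injective (hg₁e.trans hg₂e.symm)
    have hgm : g₁ ∈ maximalIdeal (MvPowerSeries (Fin 5) K) ^ 2 := hle (Submodule.mem_inf.mpr ⟨hg₁m, hg12 ▸ hg₂m⟩)
    rw [← hg₁e, mem_maximalIdeal_pow_iff_algEquiv]
    exact hgm
  -- (D) fully tangent both ways with `P₁ ⊓ P₂ ≤ 𝔪²`: no such head exists
  exfalso
  rcases hT₁' with h₁2 | h₁3 <;> rcases hT₂' with h₂2 | h₂3
  -- (2,2): graph position + the two-slot theorem produce an order-one element of the intersection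
  · obtain ⟨a, b, hab, hTab⟩ := Finset.card_eq_two.mp h₁2
    obtain ⟨a', b', hab', hTab'⟩ := Finset.card_eq_two.mp h₂2
    obtain ⟨x₁', hx₁', -, hs₁⟩ := exists_rsop_span_pair_eq' hx₁ hab
    obtain ⟨x₂', hx₂', -, hs₂⟩ := exists_rsop_span_pair_eq' hx₂ hab'
    have hc₁ : (↑T₁ : Set (Fin 5)) = {a, b} := by rw [hTab]; simp
    have hc₂ : (↑T₂ : Set (Fin 5)) = {a', b'} := by rw [hTab']; simp
    rw [hc₁, ← hs₁] at hg₁ hP₁₂ hP₂₁ hinf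
    rw [hc₂, ← hs₂] at hg₂ hP₁₂ hP₂₁ hinf
    have hT0 : (↑({0, 1} : Finset (Fin 5)) : Set (Fin 5)) = ({0, 1} : Set (Fin 5)) := by simp
    have ht : ∀ i ∈ (↑({0, 1} : Finset (Fin 5)) : Set (Fin 5)),
        x₁' i ∈ Ideal.span (x₂' '' (↑({0, 1} : Finset (Fin 5)) : Set (Fin 5))) ⊔
          maximalIdeal (MvPowerSeries (Fin 5) K) ^ 2 := by
      rw [hT0]
      intro i hi
      exact hP₁₂ (Ideal.subset_span ⟨i, hi, rfl⟩)
    obtain ⟨Ψ, φ, hφf, hφ0, hm₁, hm₂⟩ := exists_algEquiv_graph_position K ({0, 1} : Finset (Fin 5)) hx₁' hx₂' ht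
    rw [hT0] at hφf hm₁ hm₂
    obtain ⟨hy', hε', hg₁', hg₂', -⟩ := transport_head p K Ψ e hy hq hg₁ hg₂
    have hle := pull Ψ hinf
    rw [hm₁, hm₂, Set.image_pair, Set.image_pair] at hle
    rw [hm₁, Set.image_pair] at hg₁'
    rw [hm₂, Set.image_pair] at hg₂'
    obtain ⟨g, hg, hg2⟩ := exists_mem_inf_not_mem_sq_of_twoSlot p K (n := 5) (k := 0) (j := 1) (by decide)
      (hφf 0) (hφf 1) (hφ0 0) (hφ0 1) e hy' hε' hg₁' hg₂'
    exact hg2 (hle hg)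
  -- unequal heights are excluded by the generator count
  · exact false_of_three_tangent_two hx₁ hx₂ T₁ T₂ (by omega) htr₂
  · exact false_of_three_tangent_two hx₂ hx₁ T₂ T₁ (by omega) htr₁
  -- (3,3): graph position + the graph-triple row
  · obtain ⟨a, b, c, hab, hac, hbc, hTabc⟩ := Finset.card_eq_three.mp h₁3
    obtain ⟨a', b', c', hab', hac', hbc', hTabc'⟩ := Finset.card_eq_three.mp h₂3
    obtain ⟨x₁', hx₁', -, hs₁⟩ := exists_rsop_span_triple_eq hx₁ hab hac hbc
    obtain ⟨x₂', hx₂', -, hs₂⟩ := exists_rsop_span_triple_eq hx₂ hab' hac' hbc'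
    have hc₁ : (↑T₁ : Set (Fin 5)) = {a, b, c} := by rw [hTabc]; simp
    have hc₂ : (↑T₂ : Set (Fin 5)) = {a', b', c'} := by rw [hTabc']; simp
    rw [hc₁, ← hs₁] at hg₁ hP₁₂ hP₂₁ hinf
    rw [hc₂, ← hs₂] at hg₂ hP₁₂ hP₂₁ hinf
    have hT0 : (↑({0, 1, 2} : Finset (Fin 5)) : Set (Fin 5)) = ({0, 1, 2} : Set (Fin 5)) := by simp
    have ht : ∀ i ∈ (↑({0, 1, 2} : Finset (Fin 5)) : Set (Fin 5)),
        x₁' i ∈ Ideal.span (x₂' '' (↑({0, 1, 2} : Finset (Fin 5)) : Set (Fin 5))) ⊔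
          maximalIdeal (MvPowerSeries (Fin 5) K) ^ 2 := by
      rw [hT0]
      intro i hi
      exact hP₁₂ (Ideal.subset_span ⟨i, hi, rfl⟩)
    obtain ⟨Ψ, φ, hφf, hφ0, hm₁, hm₂⟩ := exists_algEquiv_graph_position K ({0, 1, 2} : Finset (Fin 5)) hx₁' hx₂' ht
    rw [hT0] at hφf hm₁ hm₂
    obtain ⟨hy', hε', hg₁', hg₂', hnot⟩ := transport_head p K Ψ e hy hq hg₁ hg₂
    have hle := pull Ψ hinf
    rw [hm₁, hm₂, span_image_zero_one_two K, span_image_zero_one_two K] at hle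
    rw [hm₁, span_image_zero_one_two K] at hg₁'
    rw [hm₂, span_image_zero_one_two K] at hg₂'
    -- the graph-triple row for `f = (φ 0, φ 1, φ 2)`
    set f : Fin 3 → MvPowerSeries (Fin 5) K := ![φ 0, φ 1, φ 2] with hfdef
    have hf : ∀ i, faceRestrictFun (R := K) (Finsupp.supported ℕ ℕ (({0, 1, 2} : Set (Fin 5))ᶜ)).toAddSubmonoid (f i)
        = f i := by
      intro i
      fin_cases i
      · exact hφf 0
      · exact hφf 1
      · exact hφf 2
    have hf0 : ∀ i, constantCoeff (f i) = 0 := by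
      intro i
      fin_cases i
      · exact hφ0 0
      · exact hφ0 1
      · exact hφ0 2
    have hrow := hGKe f hf hf0
    have hle' : Ideal.span {(X 0 : MvPowerSeries (Fin 5) K), X 1, X 2} ⊓
        Ideal.span {(X 0 : MvPowerSeries (Fin 5) K) - f 0, X 1 - f 1, X 2 - f 2} ≤
          maximalIdeal (MvPowerSeries (Fin 5) K) ^ 2 := by
      rw [inf_comm]; exact hle
    exact hnot ((hrow hle') ⟨hg₂', hg₁'⟩)


/-- [OURS · L1 W2.2] **LEVEL-`e` LEVEL-ONE CELL of `K⟦X_{Fin 5}⟧` from the graph-triple row at level `e`** (the head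
conversion of `…PairRegLevelOneRoot` / p524977, verbatim, over `exists_orderSafeAt_mem_mem_five_of_level`): the served output
`Y` has `Y − y ∈ 𝔪²`. NOT a statement of the manuscript or of any cited paper. [folklore] -/
theorem levelOne_five_of_level (e : ℕ)
    (hGKe : ∀ f : Fin 3 → MvPowerSeries (Fin 5) K,
      (∀ i, faceRestrictFun (R := K) (Finsupp.supported ℕ ℕ (({0, 1, 2} : Set (Fin 5))ᶜ)).toAddSubmonoid (f i) = f i) →
      (∀ i, constantCoeff (f i) = 0) →
      Ideal.span {(X 0 : MvPowerSeries (Fin 5) K), X 1, X 2} ⊓ Ideal.span {X 0 - f 0, X 1 - f 1, X 2 - f 2} ≤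
          maximalIdeal (MvPowerSeries (Fin 5) K) ^ 2 →
        Ideal.span {(X 0 : MvPowerSeries (Fin 5) K), X 1, X 2} ^ p ^ e ⊓
          Ideal.span {X 0 - f 0, X 1 - f 1, X 2 - f 2} ^ p ^ e ≤ maximalIdeal (MvPowerSeries (Fin 5) K) ^ (p ^ e + 1))
    (y ε : MvPowerSeries (Fin 5) K) (hy : adicOrder y = 1)
    (hε : ε ∈ maximalIdeal (MvPowerSeries (Fin 5) K) ^ (p ^ e + 1))
    (n₁ n₂ : ℕ) (x₁ : Fin n₁ → MvPowerSeries (Fin 5) K) (x₂ : Fin n₂ → MvPowerSeries (Fin 5) K)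
    (hx₁ : letI := isRegularLocalRing_mvPowerSeries K (Fin 5); IsRegularSystemOfParameters x₁)
    (hx₂ : letI := isRegularLocalRing_mvPowerSeries K (Fin 5); IsRegularSystemOfParameters x₂)
    (S₁ : Set (Fin n₁)) (S₂ : Set (Fin n₂)) (hS₁ : S₁.Nonempty) (hS₂ : S₂.Nonempty)
    (hg₁ : y ^ p ^ e + ε ∈ Ideal.span (x₁ '' S₁) ^ p ^ e) (hg₂ : y ^ p ^ e + ε ∈ Ideal.span (x₂ '' S₂) ^ p ^ e) :
    ∃ Y : MvPowerSeries (Fin 5) K, Y - y ∈ maximalIdeal (MvPowerSeries (Fin 5) K) ^ 2 ∧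
      Y ∈ Ideal.span (x₁ '' S₁) ∧ Y ∈ Ideal.span (x₂ '' S₂) := by
  letI h5 := isRegularLocalRing_mvPowerSeries K (Fin 5)
  letI h4 := isRegularLocalRing_mvPowerSeries K (Fin 4)
  haveI : IsDomain (MvPowerSeries (Fin 5) K) := isDomain_of_isRegularLocalRing _
  haveI : CharP (MvPowerSeries (Fin 5) K) p :=
    charP_of_injective_ringHom (f := (MvPowerSeries.C : K →+* MvPowerSeries (Fin 5) K)) MvPowerSeries.C_injective p
  have h5' := (isRegularSystemOfParameters_X K 5).2
  obtain rfl : n₁ = 5 := hx₁.2.symm.trans h5'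
  obtain rfl : n₂ = 5 := hx₂.2.symm.trans h5'
  have hqne : p ^ e ≠ 0 := (pow_pos hp.out.pos e).ne'
  by_cases hε0 : ε = 0
  · subst hε0
    rw [add_zero] at hg₁ hg₂
    refine ⟨y, by rw [sub_self]; exact zero_mem _, ?_, ?_⟩
    · exact (isPrime_span_image_of_isRegularSystemOfParameters hx₁ S₁).mem_of_pow_mem _
        (Ideal.pow_le_self hqne hg₁)
    · exact (isPrime_span_image_of_isRegularSystemOfParameters hx₂ S₂).mem_of_pow_mem _
        (Ideal.pow_le_self hqne hg₂)
  · obtain ⟨d, hd⟩ := ENat.ne_top_iff_exists.mp (adicOrder_ne_top hε0)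
    have hdle : ((p ^ e + 1 : ℕ) : ℕ∞) ≤ adicOrder ε := (le_adicOrder_iff ε (p ^ e + 1)).mpr hε
    have hqd : p ^ e + 1 ≤ d := by
      have : ((p ^ e + 1 : ℕ) : ℕ∞) ≤ (d : ℕ∞) := by rw [hd]; exact hdle
      exact_mod_cast this
    have hq : ((p ^ e : ℕ) : ℕ∞) < adicOrder ε := by
      rw [← hd]; exact_mod_cast (Nat.lt_of_lt_of_le (Nat.lt_succ_self _) hqd)
    obtain ⟨Y, hT1, hY₁, hY₂⟩ :=
      exists_orderSafeAt_mem_mem_five_of_level p K e hGKe hx₁ hx₂ S₁ S₂ hS₁ hS₂ y ε hy hq hg₁ hg₂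
    refine ⟨Y, ?_, hY₁, hY₂⟩
    have hT1' := (orderSafeAt_iff_sub_mem_pow p e y ε Y hd.symm).mp hT1
    have h2 : 2 ≤ (d + p ^ e - 1) / p ^ e := by
      rw [Nat.le_div_iff_mul_le (pow_pos hp.out.pos e)]
      omega
    exact Ideal.pow_le_pow_right h2 hT1'

variable (n : ℕ)

/-- [OURS · L1 W2.2] **THE HASSE/LUCAS INDUCTION, TRUNCATED AT LEVEL `E`** (res-type-014's
`tangentPairSymbolicOrderOn_of_uniformContactPairRegLevelOneOn`, p527013, verbatim with the level-one cell assumed at the levels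
`≤ E` only): on `K⟦X_{Fin n}⟧`, the level-one cells at levels `≤ E` give the head-free symbolic-order row at levels `≤ E`. NOT a
statement of the manuscript or of any cited paper. [folklore] -/
theorem tangentPair_level_of_levelOne_levels [IsRegularLocalRing (MvPowerSeries (Fin n) K)] (E : ℕ)
    (hL : ∀ e ≤ E, ∀ (y ε : MvPowerSeries (Fin n) K), adicOrder y = 1 →
      ε ∈ maximalIdeal (MvPowerSeries (Fin n) K) ^ (p ^ e + 1) →
      ∀ (n₁ n₂ : ℕ) (x₁ : Fin n₁ → MvPowerSeries (Fin n) K) (x₂ : Fin n₂ → MvPowerSeries (Fin n) K),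
        IsRegularSystemOfParameters x₁ → IsRegularSystemOfParameters x₂ →
        ∀ (S₁ : Set (Fin n₁)) (S₂ : Set (Fin n₂)), S₁.Nonempty → S₂.Nonempty →
          y ^ p ^ e + ε ∈ Ideal.span (x₁ '' S₁) ^ p ^ e → y ^ p ^ e + ε ∈ Ideal.span (x₂ '' S₂) ^ p ^ e →
            ∃ Y : MvPowerSeries (Fin n) K, Y - y ∈ maximalIdeal (MvPowerSeries (Fin n) K) ^ 2 ∧
              Y ∈ Ideal.span (x₁ '' S₁) ∧ Y ∈ Ideal.span (x₂ '' S₂)) :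
    ∀ e ≤ E, ∀ (n₁ n₂ : ℕ) (x₁ : Fin n₁ → MvPowerSeries (Fin n) K) (x₂ : Fin n₂ → MvPowerSeries (Fin n) K),
      IsRegularSystemOfParameters x₁ → IsRegularSystemOfParameters x₂ →
      ∀ (S₁ : Set (Fin n₁)) (S₂ : Set (Fin n₂)), S₁.Nonempty → S₂.Nonempty →
        Ideal.span (x₁ '' S₁) ⊓ Ideal.span (x₂ '' S₂) ≤ maximalIdeal (MvPowerSeries (Fin n) K) ^ 2 →
          Ideal.span (x₁ '' S₁) ^ p ^ e ⊓ Ideal.span (x₂ '' S₂) ^ p ^ e ≤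
            maximalIdeal (MvPowerSeries (Fin n) K) ^ (p ^ e + 1) := by
  classical
  haveI : CharP (MvPowerSeries (Fin n) K) p :=
    charP_of_injective_ringHom (f := (MvPowerSeries.C : K →+* MvPowerSeries (Fin n) K))
      MvPowerSeries.C_injective p
  haveI : ExpChar (MvPowerSeries (Fin n) K) p := ExpChar.prime hp.out
  haveI : ExpChar K p := ExpChar.prime hp.out
  intro e
  induction e using Nat.strong_induction_on with
  | _ e ih =>
  intro heE n₁ n₂ x₁ x₂ hx₁ hx₂ S₁ S₂ hS₁ hS₂ hle Γ hΓ
  obtain ⟨h₁, h₂⟩ := Submodule.mem_inf.mp hΓ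
  set q := p ^ e with hq
  have hq0 : 0 < q := pow_pos hp.out.pos e
  by_contra hΓm
  -- `P_i ≤ 𝔪`, so `Γ ∈ 𝔪^q`
  have hP₁m : Ideal.span (x₁ '' S₁) ≤ maximalIdeal (MvPowerSeries (Fin n) K) := by
    rw [Ideal.span_le]
    rintro _ ⟨j, _, rfl⟩
    exact mem_maximalIdeal_of_rsop x₁ hx₁.1 j
  have hΓq : Γ ∈ maximalIdeal (MvPowerSeries (Fin n) K) ^ q := Ideal.pow_right_mono hP₁m q h₁
  have hlow : ∀ t < e, Ideal.span (x₁ '' S₁) ^ p ^ t ⊓ Ideal.span (x₂ '' S₂) ^ p ^ t ≤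
      maximalIdeal (MvPowerSeries (Fin n) K) ^ (p ^ t + 1) :=
    fun t ht => ih t ht (le_trans ht.le heE) n₁ n₂ x₁ x₂ hx₁ hx₂ S₁ S₂ hS₁ hS₂ hle
  -- the degree-`q` coefficients of `Γ` are supported on the `q`-th powers of the variables
  have key : ∀ α : Fin n →₀ ℕ, α.degree = q → coeff α Γ ≠ 0 → ∃ i, α = Finsupp.single i q :=
    fun α hα hc => exists_eq_single_of_coeff_ne_zero p K n e _ _ hlow h₁ h₂ hα hc
  -- the `q`-th roots of those coefficients give a linear form `y`
  set c : Fin n → K := fun i => coeff (Finsupp.single i q) Γ with hc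
  set r : Fin n → K := fun i => (iterateFrobeniusEquiv K p e).symm (c i) with hr
  have hrq : ∀ i, r i ^ q = c i := fun i => by
    rw [hr]; simp only
    rw [← iterateFrobeniusEquiv_def, RingEquiv.apply_symm_apply]
  set y : MvPowerSeries (Fin n) K := ∑ i, C (r i) * X i with hy
  have hyq : y ^ q = ∑ i, C (c i) * X i ^ q := by
    rw [hy, hq, sum_pow_char_pow]
    refine Finset.sum_congr rfl fun i _ => ?_
    rw [mul_pow, ← map_pow, ← hq, hrq]
  -- some degree-`q` coefficient of `Γ` is non-zero (as `Γ ∉ 𝔪^{q+1}`), hence some `r i ≠ 0`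
  obtain ⟨i₀, hi₀⟩ : ∃ i, c i ≠ 0 := by
    by_contra hall
    push Not at hall
    apply hΓm
    refine Jets.mem_maximalIdeal_pow_of_coeff_eq_zero fun α hα => ?_
    by_cases hαq : α.degree < q
    · exact Jets.coeff_eq_zero_of_mem_maximalIdeal_pow hΓq hαq
    · have hαq' : α.degree = q := by omega
      by_contra hcα
      obtain ⟨i, rfl⟩ := key α hαq' hcα
      exact hcα (hall i)
  have hri₀ : r i₀ ≠ 0 := by
    intro h0
    apply hi₀
    rw [← hrq i₀, h0, zero_pow hq0.ne']
  -- `y` is a regular parameter: `y ∈ 𝔪 ∖ 𝔪²`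
  have hym : y ∈ maximalIdeal (MvPowerSeries (Fin n) K) := by
    rw [hy]
    refine Ideal.sum_mem _ fun i _ => Ideal.mul_mem_left _ _ ?_
    exact (maximalIdeal_mvPowerSeries_eq_span K (Fin n)).symm ▸ Ideal.subset_span (Set.mem_range_self i)
  have hcoeffy : coeff (Finsupp.single i₀ 1) y = r i₀ := by
    rw [hy, map_sum]
    simp only [coeff_C_mul, coeff_index_single_X]
    rw [Finset.sum_eq_single i₀ (fun j _ hj => by rw [if_neg (Ne.symm hj), mul_zero])
      (fun h => absurd (Finset.mem_univ i₀) h), if_pos rfl, mul_one]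
  have hy2 : y ∉ maximalIdeal (MvPowerSeries (Fin n) K) ^ 2 := by
    intro h
    have := Jets.coeff_eq_zero_of_mem_maximalIdeal_pow h
      (e := Finsupp.single i₀ 1) (by rw [Finsupp.degree_single]; omega)
    rw [hcoeffy] at this
    exact hri₀ this
  have hyord : adicOrder y = 1 := by
    have h1 : ((1 : ℕ) : ℕ∞) ≤ adicOrder y := (le_adicOrder_iff y 1).mpr (by rw [pow_one]; exact hym)
    have h2 : ¬ ((2 : ℕ) : ℕ∞) ≤ adicOrder y := fun h => hy2 ((le_adicOrder_iff y 2).mp h)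
    have h3 : adicOrder y < ((2 : ℕ) : ℕ∞) := not_le.mp h2
    have h4 : adicOrder y ≠ ⊤ := by rintro h; rw [h] at h3; exact absurd h3 (by simp)
    obtain ⟨a, ha⟩ := ENat.ne_top_iff_exists.mp h4
    rw [← ha] at h1 h3 ⊢
    have : a = 1 := by
      have h1' : 1 ≤ a := by exact_mod_cast h1
      have h3' : a < 2 := by exact_mod_cast h3
      omega
    rw [this]; rfl
  -- `ε := Γ − y^q ∈ 𝔪^{q+1}`
  set ε : MvPowerSeries (Fin n) K := Γ - y ^ q with hε
  have hcoeffq : ∀ α : Fin n →₀ ℕ, coeff α (y ^ q) = ∑ i, c i * (if α = Finsupp.single i q then 1 else 0) := by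
    intro α
    rw [hyq, map_sum]
    simp only [coeff_C_mul, coeff_X_pow]
  have hεm : ε ∈ maximalIdeal (MvPowerSeries (Fin n) K) ^ (q + 1) := by
    refine Jets.mem_maximalIdeal_pow_of_coeff_eq_zero fun α hα => ?_
    rw [hε, map_sub, hcoeffq]
    by_cases hαq : α.degree < q
    · rw [Jets.coeff_eq_zero_of_mem_maximalIdeal_pow hΓq hαq, zero_sub, neg_eq_zero]
      refine Finset.sum_eq_zero fun i _ => ?_
      rw [if_neg, mul_zero]
      intro h
      rw [h, Finsupp.degree_single] at hαq
      exact lt_irrefl _ hαq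
    · have hαq' : α.degree = q := by omega
      by_cases hex : ∃ i, α = Finsupp.single i q
      · obtain ⟨i, rfl⟩ := hex
        rw [Finset.sum_eq_single i (fun j _ hj => ?_) (fun h => absurd (Finset.mem_univ i) h),
          if_pos rfl, mul_one, sub_self]
        rw [if_neg, mul_zero]
        intro h
        rw [Finsupp.single_eq_single_iff] at h
        rcases h with ⟨hij, _⟩ | ⟨h0, _⟩
        · exact hj hij.symm
        · exact hq0.ne' h0
      · push Not at hex
        have hc0 : coeff α Γ = 0 := by
          by_contra hcα
          obtain ⟨i, hi⟩ := key α hαq' hcα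
          exact hex i hi
        rw [hc0, zero_sub, neg_eq_zero]
        refine Finset.sum_eq_zero fun i _ => ?_
        rw [if_neg (hex i), mul_zero]
  have hΓeq : y ^ q + ε = Γ := by rw [hε]; ring
  -- the level-one rung produces a common order-one parameter, contradicting `P₁ ⊓ P₂ ≤ 𝔪²`
  obtain ⟨Y₀, hY₀y, hY₀₁, hY₀₂⟩ := hL e heE y ε hyord hεm n₁ n₂ x₁ x₂ hx₁ hx₂ S₁ S₂ hS₁ hS₂
    (by rw [hΓeq]; exact h₁) (by rw [hΓeq]; exact h₂)
  apply hy2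
  have h1 : y = Y₀ - (Y₀ - y) := by ring
  rw [h1]

  exact sub_mem (hle ⟨hY₀₁, hY₀₂⟩) hY₀y


end Levelwise

end CampaignW22
end Summit.ResolutionOfSingularities.ResolutionOfSingularities.Theorems

end
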